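import Literature.AlgebraicGeometry.Modules.AffineVanishing
import Literature.AlgebraicGeometry.Modules.LocalExactness
import Literature.AlgebraicGeometry.Modules.IsoOfSectionsOnBasis
import Literature.AlgebraicGeometry.Motives.FlasqueOpenCohomology
import Literature.Algebra.Homology.HomAcyclicComplexExact
import Literature.Algebra.Homology.LeftExactAcyclicClass
import Mathlib.AlgebraicGeometry.Morphisms.Affine
import HarnessLib

/-!
# Leray's acyclicity lemma for an affine morphism: `g_*` of an injective resolution of a bounded-below
# complex of quasi-coherent modules is a resolution (`R g_* E• = g_* E•`; Hartshorne III.8.1, Stacks 01XC)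

Let `g : X → Y` be an AFFINE morphism of schemes, `E•` a bounded-below cochain complex of
`𝒪_X`-modules whose terms are affine-localizing (e.g. quasi-coherent, e.g. vector bundles —
`Modules/AffineLocalizing`), and `ι : E• → I•` a quasi-isomorphism into a bounded-below complex of
INJECTIVE `𝒪_X`-modules (an injective resolution). Then the termwise direct image
`g_*ι : g_*E• → g_*I•` is again a quasi-isomorphism (`quasiIso_pushforward_map_of_injective`). In the
language of derived functors: `Rg_*(E•) ≅ g_*(E•)` — quasi-coherent modules are `g_*`-acyclic for an
affine morphism (`Rⁱg_*ℱ = 0`, `i > 0`: Hartshorne III Prop. 8.1 for noetherian separated data,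
The Stacks Project Tag 01XC in general), and bounded-below complexes of acyclic objects compute the
derived functor (Leray's acyclicity lemma, Weibel Cor. 5.7.7 / 10.5.9, Hartshorne III Prop. 1.2A).

Proof (printed route, Zariski-local form). The cone `C• = Cone(ι)` is acyclic and bounded below with
terms `Eⁿ⁺¹ ⊞ Iⁿ`; `g_*` commutes with cones (`CochainComplex.mappingCone.mapHomologicalComplexIso`),
so it suffices that `g_*C•` is acyclic, i.e. (exactness of sheaves is local on sections,
`Modules/LocalExactness.exact_of_locally_exact`) that every cycle of `Γ(g⁻¹V, C•) = Γ(V, g_*C•)` is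
a boundary over small `V`. For `V` affine, `U = g⁻¹V` is affine (`g` affine), and the complex of
sections `Γ(U, C•) = Hom(ℤ[h_U], C•)` IS exact: by Serre's vanishing theorem
(`Modules/AffineVanishing`: `Hⁱ(U, Eⁿ) = Extⁱ(ℤ[h_U], Eⁿ) = 0`) and the flasqueness of injective modules
(`Motives/FlasqueOpenCohomology`: `Extⁱ(ℤ[h_U], Iⁿ) = 0`) every term of `C•` is `Γ(U, –)`-acyclic, and
an acyclic bounded-below complex of `Γ(U, –)`-acyclic sheaves has an exact complex of sections
(`Algebra/Homology/HomAcyclicComplexExact`).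

* (`φ` is a quasi-isomorphism iff `Cone(φ)` is acyclic: the tree's
  `Algebra/Homology/LeftExactAcyclicClass.AcyclicClass.quasiIso_iff_acyclic_mappingCone`, core-w7);
* `subsingleton_ext_of_iso`, `subsingleton_ext_freeSheaf_succ_of_isAffineLocalizing_biprod_injective`
  — bookkeeping: the cone terms `Eⁿ⁺¹ ⊞ Iⁿ` are `Γ(U, –)`-acyclic on affine `U`;
* `exists_app_d_eq_of_acyclic` — **sections of an acyclic bounded-below complex of `Γ(U, –)`-acyclic
  `𝒪_X`-modules over an affine open `U` form an exact complex**;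
* `acyclic_pushforward_of_acyclic` — **`g_*C•` is acyclic** for such `C•` and `g` affine;
* `quasiIso_pushforward_map_of_injective` — **Leray: `g_*ι` is a quasi-isomorphism**.

Everything is proved; no named facts.

## References

* R. Hartshorne, *Algebraic Geometry*, GTM 52, Springer (1977), III Prop. 1.2A, Prop. 2.5,
  Prop. 8.1 (p. 250). [Hartshorne1977]
* The Stacks Project, Tag 01XC (Cohomology of Schemes, Lemma 30.2.3: higher direct images of
  quasi-coherent modules along an affine morphism vanish), Tag 01XB. [StacksProject]
* C. A. Weibel, *An introduction to homological algebra* (1994), Cor. 5.7.7, Cor. 10.5.9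
  (Leray acyclicity / generalized existence of hyper-derived functors). [Weibel1994]
-/

noncomputable section

-- `TopCat.Presheaf`/`Scheme.Modules` are not reducible (as in Mathlib's `AlgebraicGeometry/Modules/Sheaf.lean`).
set_option backward.isDefEq.respectTransparency false

open CategoryTheory CategoryTheory.Limits CategoryTheory.Abelian AlgebraicGeometry Opposite
  TopologicalSpace
open Literature.Algebra.Homology Literature.AlgebraicGeometry.Motives
  Literature.AlgebraicGeometry.HodgeTheory

universe w v u

namespace Literature.AlgebraicGeometry.Modules

/-! ### Bookkeeping (generic) -/

section Cone

variable {C : Type u} [Category.{v} C] [Abelian C]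

/-- `Ext`-vanishing into an object is invariant under isomorphism of that object. [cite: Weibel1994, Prop. 3.3.4 (2)] -/
theorem subsingleton_ext_of_iso [HasExt.{w} C] (P : C) {Y Y' : C} (e : Y ≅ Y') (i : ℕ)
    [h : Subsingleton (Ext P Y' i)] : Subsingleton (Ext P Y i) := by
  refine subsingleton_of_forall_eq 0 fun x => ?_
  have hx : x = (x.comp (Ext.mk₀ e.hom) (add_zero i)).comp (Ext.mk₀ e.inv) (add_zero i) := by
    rw [Ext.comp_assoc_of_second_deg_zero, Ext.mk₀_comp_mk₀, e.hom_inv_id, Ext.comp_mk₀_id]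
  rw [hx, Subsingleton.elim (x.comp (Ext.mk₀ e.hom) (add_zero i)) 0, Ext.zero_comp]

end Cone

/-! ### Sections of acyclic complexes of `Γ(U, –)`-acyclic modules over an affine open -/

section Sections

variable {X : Scheme.{u}}

/-- The cone terms are `Γ(U, –)`-acyclic: for `U` an affine open, `E` affine-localizing (Serre, Tag 01XB)
and `I` an injective `𝒪_X`-module (flasque, III.2.4–2.5), `Extⁿ⁺¹(ℤ[h_U], E ⊞ I) = 0`.
[cite: StacksProject, Tag 01XB] [cite: Hartshorne1977, III Prop. 2.5] -/
theorem subsingleton_ext_freeSheaf_succ_of_isAffineLocalizing_biprod_injective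
    [HasExt.{w} (Sheaf (Opens.grothendieckTopology X.carrier) AddCommGrpCat.{u})]
    {U : X.Opens} (hU : IsAffineOpen U) (E I : X.Modules) (hE : IsAffineLocalizing E) [Injective I]
    (n : ℕ) :
    Subsingleton (Ext.{w} (freeSheaf.{u} (Opens.grothendieckTopology X) U)
      ((modulesToSheaf X).obj (E ⊞ I)) (n + 1)) := by
  haveI : Subsingleton (Ext.{w} (freeSheaf.{u} (Opens.grothendieckTopology X) U)
      ((modulesToSheaf X).obj E) (n + 1)) :=
    AffineVanishing.subsingleton_ext_freeSheaf_of_isAffineOpen E hE hU n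
  haveI : Subsingleton (Ext.{w} (freeSheaf.{u} (Opens.grothendieckTopology X) U)
      ((modulesToSheaf X).obj I) (n + 1)) :=
    subsingleton_ext_freeSheaf_succ_of_injective_modules I U n
  haveI : Subsingleton (Ext.{w} (freeSheaf.{u} (Opens.grothendieckTopology X) U)
      ((modulesToSheaf X).obj E ⊞ (modulesToSheaf X).obj I) (n + 1)) :=
    subsingleton_ext_biprod _ _ _ _
  haveI := Limits.preservesBinaryBiproduct_of_preservesBinaryProduct (modulesToSheaf X) (X := E) (Y := I)
  exact subsingleton_ext_of_iso (freeSheaf.{u} (Opens.grothendieckTopology X) U)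
    ((modulesToSheaf X).mapBiprod E I) (n + 1)

/-- The underlying complex of abelian sheaves of an acyclic complex of `𝒪_X`-modules is acyclic
(the forgetful functor is exact). [cite: Hartshorne1977, III Prop. 2.6 (proof: Mod(X) → Ab(X) exact)] -/
theorem acyclic_modulesToSheaf (K : CochainComplex X.Modules ℤ) (hK : K.Acyclic) :
    (((modulesToSheaf X).mapHomologicalComplex (ComplexShape.up ℤ)).obj K).Acyclic := by
  intro n
  rw [HomologicalComplex.exactAt_iff' _ (n - 1) n (n + 1) (by simp) (by simp)]
  exact ((K.exactAt_iff' (n - 1) n (n + 1) (by simp) (by simp)).mp (hK n)).map (modulesToSheaf X)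

/-- **Exactness of sections over an affine open.** Let `C•` be an acyclic cochain complex of
`𝒪_X`-modules, bounded below, such that for the affine open `U` every term is `Γ(U, –)`-acyclic
(`Extⁱ(ℤ[h_U], Cⁿ) = 0`, `i ≥ 1` — e.g. `Cⁿ = Eⁿ⁺¹ ⊞ Iⁿ` with `E` affine-localizing and `I` injective).
Then the complex of sections `Γ(U, C•)` is exact: every section `s ∈ Γ(U, Cᵐ)` with `d s = 0` is
`d t` for some `t ∈ Γ(U, Cⁿ)`, `n + 1 = m` (`Γ(U, –) = Hom(ℤ[h_U], –)` on abelian sheaves and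
`Algebra/Homology/HomAcyclicComplexExact`).
[cite: Hartshorne1977, III Prop. 1.2A] [cite: Weibel1994, Cor. 5.7.7 (1), (3)] -/
theorem exists_app_d_eq_of_acyclic (C : CochainComplex X.Modules ℤ) (hC : C.Acyclic) (a : ℤ)
    (ha : ∀ n, n < a → IsZero (C.X n)) {U : X.Opens}
    (hU : ∀ (n : ℤ) (i : ℕ), 1 ≤ i → Subsingleton (Ext.{u} (freeSheaf.{u}
      (Opens.grothendieckTopology X) U) ((modulesToSheaf X).obj (C.X n)) i))
    (n m l : ℤ) (hnm : n + 1 = m) (hml : m + 1 = l) (s : Γ(C.X m, U))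
    (hs : (C.d m l).app U s = 0) :
    ∃ t : Γ(C.X n, U), (C.d n m).app U t = s := by
  let K := ((modulesToSheaf X).mapHomologicalComplex (ComplexShape.up ℤ)).obj C
  have hK : ∀ n, K.ExactAt n := acyclic_modulesToSheaf C hC
  have hKa : ∀ n, n < a → IsZero (K.X n) := fun n hn => (modulesToSheaf X).map_isZero (ha n hn)
  -- sections over `U` are morphisms from the free abelian sheaf `ℤ[h_U]`
  let P := freeSheaf.{u} (Opens.grothendieckTopology X) U
  have happ : ∀ (p q : ℤ) (φ : P ⟶ K.X p),
      freeSheafHomEquiv U (K.X q) (φ ≫ K.d p q) = (C.d p q).app U (freeSheafHomEquiv U (K.X p) φ) :=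
    fun p q φ => freeSheafHomEquiv_comp U (K.X p) φ (K.d p q)
  have hzero : ∀ (p q : ℤ) (φ : P ⟶ K.X p), freeSheafHomEquiv U (K.X q) (0 : P ⟶ K.X q) = 0 := by
    intro p q φ
    have h := freeSheafHomEquiv_comp U (K.X p) φ (0 : K.X p ⟶ K.X q)
    rw [comp_zero] at h
    rw [h]; rfl
  let f : P ⟶ K.X m := (freeSheafHomEquiv U (K.X m)).symm s
  have hf : f ≫ K.d m l = 0 := by
    apply (freeSheafHomEquiv U (K.X l)).injective
    rw [happ, Equiv.apply_symm_apply, hzero m l f]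
    exact hs
  obtain ⟨h, hh⟩ := exists_comp_d_eq_of_acyclic_of_ext_subsingleton P K hK a hKa hU n m l hnm hml
    f hf
  refine ⟨freeSheafHomEquiv U (K.X n) h, ?_⟩
  rw [← happ, hh, Equiv.apply_symm_apply]

end Sections

/-! ### Leray's acyclicity lemma for an affine morphism -/

section Leray

variable {X Y : Scheme.{u}} (g : X ⟶ Y) [IsAffineHom g]

/-- **`g_*C•` is acyclic** for `g` affine and `C•` an acyclic bounded-below complex of `𝒪_X`-modules
whose terms are `Γ(U, –)`-acyclic on every affine open `U` (`Extⁱ(ℤ[h_U], Cⁿ) = 0`, `i ≥ 1`):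
exactness of `g_*C•` is local on sections (`exact_of_locally_exact`), affine opens `V ⊆ Y` form a basis,
`g⁻¹V` is affine, and there the sections form an exact complex (`exists_app_d_eq_of_acyclic`).
[cite: StacksProject, Tag 01XC] [cite: Hartshorne1977, III Prop. 8.1 (proof)] -/
theorem acyclic_pushforward_of_acyclic (C : CochainComplex X.Modules ℤ) (hC : C.Acyclic) (a : ℤ)
    (ha : ∀ n, n < a → IsZero (C.X n))
    (hU : ∀ (U : X.Opens), IsAffineOpen U → ∀ (n : ℤ) (i : ℕ), 1 ≤ i →
      Subsingleton (Ext.{u} (freeSheaf.{u} (Opens.grothendieckTopology X) U)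
        ((modulesToSheaf X).obj (C.X n)) i)) :
    (((Scheme.Modules.pushforward g).mapHomologicalComplex (ComplexShape.up ℤ)).obj C).Acyclic := by
  intro q
  rw [HomologicalComplex.exactAt_iff' _ (q - 1) q (q + 1) (by simp) (by simp)]
  apply exact_of_locally_exact
  intro V s hs y hy
  -- an affine neighbourhood `V' ∋ y` inside `V`; its preimage is affine
  obtain ⟨V', hV'aff, hyV', hV'V⟩ := (Opens.isBasis_iff_nbhd.mp Y.isBasis_affineOpens) hy
  have hUaff : IsAffineOpen (g ⁻¹ᵁ V') := IsAffineOpen.preimage hV'aff g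
  let i : V' ⟶ V := homOfLE hV'V
  -- restrict the cycle `s ∈ Γ(g⁻¹V, Cᵠ)` to `g⁻¹V'`
  let s' : Γ(C.X q, g ⁻¹ᵁ V') := (C.X q).presheaf.map ((Opens.map g.base).map i).op s
  have hs' : (C.d q (q + 1)).app (g ⁻¹ᵁ V') s' = 0 := by
    have hs0 : (C.d q (q + 1)).app (g ⁻¹ᵁ V) s = 0 := hs
    change (C.d q (q + 1)).app (g ⁻¹ᵁ V') ((C.X q).presheaf.map ((Opens.map g.base).map i).op s) = 0
    rw [app_presheaf_map, hs0, map_zero]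
  obtain ⟨t, ht⟩ := exists_app_d_eq_of_acyclic C hC a ha (hU _ hUaff) (q - 1) q (q + 1) (by omega)
    rfl s' hs'
  exact ⟨V', i, hyV', t, ht⟩

/-- **Leray's acyclicity lemma for an affine morphism** (`Rg_*E• = g_*E•` for a bounded-below complex
of quasi-coherent modules): for `g : X → Y` affine, `E•` a bounded-below complex of affine-localizing
(e.g. quasi-coherent) `𝒪_X`-modules, `I•` a bounded-below complex of injective `𝒪_X`-modules and
`ι : E• → I•` a quasi-isomorphism, **`g_*ι : g_*E• → g_*I•` is a quasi-isomorphism**. (The cone of `ι`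
is acyclic, bounded below, with terms `Eⁿ⁺¹ ⊞ Iⁿ` that are `Γ(U, –)`-acyclic on affine opens `U` by
Serre's vanishing theorem and flasqueness of injectives; `g_*` commutes with cones; apply
`acyclic_pushforward_of_acyclic`.) [cite: Hartshorne1977, III Prop. 8.1 and Prop. 1.2A]
[cite: StacksProject, Tag 01XC] [cite: Weibel1994, Cor. 5.7.7 and Cor. 10.5.9] -/
theorem quasiIso_pushforward_map_of_injective {E I : CochainComplex X.Modules ℤ} (ι : E ⟶ I)
    [QuasiIso ι] (a : ℤ) (hEa : ∀ n, n < a → IsZero (E.X n)) (hIa : ∀ n, n < a → IsZero (I.X n))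
    (hE : ∀ n, IsAffineLocalizing (E.X n)) (hI : ∀ n, Injective (I.X n)) :
    QuasiIso (((Scheme.Modules.pushforward g).mapHomologicalComplex (ComplexShape.up ℤ)).map ι) := by
  rw [AcyclicClass.quasiIso_iff_acyclic_mappingCone]
  have hcone : (CochainComplex.mappingCone ι).Acyclic :=
    (AcyclicClass.quasiIso_iff_acyclic_mappingCone ι).mp ‹_›
  -- the cone is bounded below (by `a - 1`) with `Γ(U, –)`-acyclic terms on affine opens
  have hca : ∀ n, n < a - 1 → IsZero ((CochainComplex.mappingCone ι).X n) := fun n hn =>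
    (CochainComplex.mappingCone.isZero_X_iff ι n).mpr ⟨hEa _ (by omega), hIa _ (by omega)⟩
  have hcU : ∀ (U : X.Opens), IsAffineOpen U → ∀ (n : ℤ) (i : ℕ), 1 ≤ i →
      Subsingleton (Ext.{u} (freeSheaf.{u} (Opens.grothendieckTopology X) U)
        ((modulesToSheaf X).obj ((CochainComplex.mappingCone ι).X n)) i) := by
    intro U hU n i hi
    obtain ⟨j, rfl⟩ := Nat.exists_eq_add_one_of_ne_zero (by omega : i ≠ 0)
    haveI := hI n
    haveI : Subsingleton (Ext.{u} (freeSheaf.{u} (Opens.grothendieckTopology X) U)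
        ((modulesToSheaf X).obj (E.X (n + 1) ⊞ I.X n)) (j + 1)) :=
      subsingleton_ext_freeSheaf_succ_of_isAffineLocalizing_biprod_injective hU
        (E.X (n + 1)) (I.X n) (hE _) j
    exact subsingleton_ext_of_iso _ ((modulesToSheaf X).mapIso
      (HomologicalComplex.homotopyCofiber.XIsoBiprod ι n (n + 1) rfl)) _
  have hpush := acyclic_pushforward_of_acyclic g (CochainComplex.mappingCone ι) hcone (a - 1) hca hcU
  -- `g_*` commutes with the cone
  intro n
  exact (exactAt_iff_of_quasiIsoAt
    (CochainComplex.mappingCone.mapHomologicalComplexIso ι (Scheme.Modules.pushforward g)).hom n).mp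
    (hpush n)

/-- **Leray for bounded-below complexes of vector bundles** (the form the derived `Ext`-adjunction
along an isogeny consumes): `g_*` of an injective resolution of a bounded-below complex of finite
locally free `𝒪_X`-modules is a quasi-isomorphism, `g` affine. [cite: Hartshorne1977, III Prop. 8.1]
[cite: StacksProject, Tag 01XC] -/
theorem quasiIso_pushforward_map_of_injective_of_isFiniteLocallyFree {E I : CochainComplex X.Modules ℤ}
    (ι : E ⟶ I) [QuasiIso ι] (a : ℤ) (hEa : ∀ n, n < a → IsZero (E.X n))
    (hIa : ∀ n, n < a → IsZero (I.X n)) (hE : ∀ n, IsFiniteLocallyFree (E.X n))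
    (hI : ∀ n, Injective (I.X n)) :
    QuasiIso (((Scheme.Modules.pushforward g).mapHomologicalComplex (ComplexShape.up ℤ)).map ι) :=
  quasiIso_pushforward_map_of_injective g ι a hEa hIa
    (fun n => by
      haveI := (hE n).isVectorBundle.1
      exact IsAffineLocalizing.of_isQuasicoherent (E.X n)) hI

end Leray

end Literature.AlgebraicGeometry.Modules

end
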